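import Summits.QuantumFields.YangMills.Theorems.DiagonalMirrorRPRWilsonDiagonalModelMirrorFamily
import Summits.QuantumFields.YangMills.Theorems.DiagonalMirrorRPRWilsonDiagonalModelOddTorusChain

/-!
# Crux `WeakCouplingHypercubicLimitRP` (stmt-QuantumFields-27398) / aside `DiagonalMirrorRPR` (stmt-QuantumFields-10604), door B,
# construction F1_diag — PAIRING LAYER, step P2 (insertion form): `⟨ΘY·Y⟩_k · Tr K_u^S` as the cyclic `K_u`-chain with the family
# observable and its mirror INSERTED, and the layers of the swapped configuration

Helper file (`--supports stmt-QuantumFields-27398 --as helper`) of the hand `hand-10604-wilsonDiagModel-2` (docket director-ym g23, O4 WORD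
18 (3)(iii) / 20 (1); step P2 of hand-1's ROADMAP-F1diag v4 §1⅞) for the registered stub D1 `stub_diagRPOfPlaneLimits` of
`Cruxes/WeakCouplingHypercubicLimitRP/Lines/Sketch.lean` (sha16 `7bf38c709623ad77`); it closes nothing by itself.

WHAT.
* §1 `layerReadU_swap_layerAssembleU` — the layers of the SWAPPED assembled configuration: layer `t` of `P_swap (assemble Z)` is
  `glue (Θ (bonds (Z (1 − t)))) (inslab (Z (−t)))` (hand-1's fibrewise swap `inslab_layerReadU_swap` / `bonds_layerReadU_swap`, p825750, read
  through `layerReadU_layerAssembleU`): the mirror exchanges the half-layer types around slab `0` and twists bond labels by `Θ`, with NO slab shift.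
* §2 **`gramPairing_mul_diagCyclicTraceU_eq`** (P2, insertion form): for every reflected family `F` and step `k`,
  `gramPairing r sch F k · Tr K_u^{S_k} = ∫ Y_k(F)((P_swap (assemble Z))~) · Y_k(F)((assemble Z)~) · ∏_t K_u(Z_t, Z_{t+1}) dZ`
  over symmetric-chart layer strings `Z : ℤ/S_kℤ → LayerCfg` (product layer Haar measure) — `gramPairing_eq_integral_famObs_swap` (P1′) through
  hand-1's `integral_wilsonMeasure_eq_diagCyclicU`; and the normalised form `gramPairing_eq_integral_layers_div`.  By P1
  (`exists_famDepth_layerAssembleU`) the second insertion reads only `Z_1 … Z_{d_k}`, by §1 + P1 the first reads only `Z_{−d_k} … Z_0`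
  (eventually in `k`, `2 d_k < S_k`), which is the geometry the sandwich identity P3 (`Σ κ^{S−2d} ⟨b, 𝒯†𝒯 b⟩` through the feature lift and
  hand-1's `exists_eigenPackage`) starts from.

HONEST FRAMING: construction bookkeeping only; `wilsonDiagonalModel` is NOT landed (P3 sandwich/positivity, P4 weight domination and the assembly
remain — hand-1's ROADMAP-F1diag v4 §1⅞); no letter is proved; D1, ⟨27398⟩, S6i and the aside ⟨10604⟩ are OPEN; nothing here bears on the summit;
the Yang–Mills mass gap is NOT proved here or anywhere in the tree.  No definition, no instance, no notation, `autoImplicit false`.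

References: K. Osterwalder, E. Seiler, Ann. Phys. 110 (1978) §2–3 (transfer-matrix form of reflected expectations); E. Seiler, LNP 159 (1982)
Ch. 2.
-/

set_option autoImplicit false

noncomputable section

open scoped SchwartzMap
open MeasureTheory Filter Topology
open Literature.MathematicalPhysics.QuantumLattice Literature.MathematicalPhysics.AQFT
  Literature.MathematicalPhysics.QuantumFieldTheory
open Summit.QuantumFields.YangMills.Cruxes.DiagonalMirrorRPR.ParityBridgeColdTraces (E4)

namespace Summit.QuantumFields.YangMills.Cruxes.DiagonalMirrorRPR.SignTwistedDiagonalTrace.WilsonDiagonal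

/-! ## §1 The layers of the swapped assembled configuration -/

section SwapLayers

variable {S : ℕ} {G : Type*} [MeasurableSpace G]

/-- **Layers of the swapped configuration.**  For odd `S`, layer `t` of `P_swap (layerAssembleU Z)` glues the `Θ`-twisted bonds of layer `1 − t`
to the in-slab links of layer `−t`: the swap `x₀ ↔ x₁` acts on the symmetric chart by `v ↦ −v` only. -/
theorem layerReadU_swap_layerAssembleU (hS : Odd S) (Z : ZMod S → LayerCfg S S G) (t : ZMod S) :
    layerReadU (configPerm (Equiv.swap (0 : Fin 4) 1) (layerAssembleU Z)) t =
      glue (thetaHalf (bonds (Z (1 - t)))) (inslab (Z (-t))) := by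
  rw [← glue_bonds_inslab (layerReadU (configPerm (Equiv.swap (0 : Fin 4) 1) (layerAssembleU Z)) t),
    bonds_layerReadU_swap hS, inslab_layerReadU_swap hS, layerReadU_layerAssembleU hS]

/-- In particular two layer strings that agree on `Z (1 − t)` and `Z (−t)` give the same layer `t` after the swap. -/
theorem layerReadU_swap_layerAssembleU_congr (hS : Odd S) {Z Z' : ZMod S → LayerCfg S S G} {t : ZMod S}
    (h1 : Z (1 - t) = Z' (1 - t)) (h0 : Z (-t) = Z' (-t)) :
    layerReadU (configPerm (Equiv.swap (0 : Fin 4) 1) (layerAssembleU Z)) t =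
      layerReadU (configPerm (Equiv.swap (0 : Fin 4) 1) (layerAssembleU Z')) t := by
  rw [layerReadU_swap_layerAssembleU hS, layerReadU_swap_layerAssembleU hS, h1, h0]

end SwapLayers

/-! ## §2 P2: the insertion form of the Gram pairing -/

section Insertion

variable {G : Type} [Group G] [TopologicalSpace G] [IsTopologicalGroup G] [CompactSpace G]
  [MeasurableSpace G] [BorelSpace G] (r : LatticeRep G) (sch : SpeciesScheme (YMSpecies G))

/-- The normalised insertion form: `gramPairing r sch F k = (∫ (Y∘P)(assemble Z)~ · Y (assemble Z)~ · ∏_t K_u(Z_t,Z_{t+1}) dZ) / Tr K_u^{S_k}`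
(`gramPairing_eq_integral_famObs_swap` through `integral_wilsonMeasure_eq_diagCyclicU`; the scheme's torus side `2L_k+1` is odd). -/
theorem gramPairing_eq_integral_layers_div (F : ReflectedFamily) (k : ℕ) :
    gramPairing r sch F k =
      (∫ Z : ZMod (sch.side k) → LayerCfg (sch.side k) (sch.side k) G,
          famObs r sch F k (torusLift (sch.side k) (configPerm (Equiv.swap (0 : Fin 4) 1) (layerAssembleU Z))) *
              famObs r sch F k (torusLift (sch.side k) (layerAssembleU Z)) *
            ∏ t : ZMod (sch.side k), stepKernelU r.ρ (sch.β k) (Z t) (Z (t + 1))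
          ∂(Measure.pi fun _ => layerHaar (sch.side k) (sch.side k) G)) /
        diagCyclicTraceU r.ρ (sch.β k) (sch.side k) (S := sch.side k) (G := G) := by
  haveI : SecondCountableTopology G :=
    (r.continuous.isClosedEmbedding r.injective).isEmbedding.secondCountableTopology
  rw [gramPairing_eq_integral_famObs_swap]
  exact integral_wilsonMeasure_eq_diagCyclicU r.ρ (sch.β k) ⟨sch.L k, rfl⟩ r.continuous _

/-- **P2 — insertion form.**  `gramPairing r sch F k · Tr K_u^{S_k} = ∫ (Y∘P_swap)((assemble Z)~) · Y((assemble Z)~) · ∏_t K_u(Z_t, Z_{t+1}) dZ`: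
the Gram pairing of the interface times the cyclic trace of the symmetric-chart kernel is the cyclic `K_u`-chain over symmetric-chart layer
strings with the family observable and its mirror inserted (`Tr K_u^{S_k} > 0`, `diagCyclicTraceU_side_pos`). -/
theorem gramPairing_mul_diagCyclicTraceU_eq (F : ReflectedFamily) (k : ℕ) :
    gramPairing r sch F k * diagCyclicTraceU r.ρ (sch.β k) (sch.side k) (S := sch.side k) (G := G) =
      ∫ Z : ZMod (sch.side k) → LayerCfg (sch.side k) (sch.side k) G,
          famObs r sch F k (torusLift (sch.side k) (configPerm (Equiv.swap (0 : Fin 4) 1) (layerAssembleU Z))) *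
              famObs r sch F k (torusLift (sch.side k) (layerAssembleU Z)) *
            ∏ t : ZMod (sch.side k), stepKernelU r.ρ (sch.β k) (Z t) (Z (t + 1))
          ∂(Measure.pi fun _ => layerHaar (sch.side k) (sch.side k) G) := by
  haveI : SecondCountableTopology G :=
    (r.continuous.isClosedEmbedding r.injective).isEmbedding.secondCountableTopology
  have hpos : 0 < diagCyclicTraceU r.ρ (sch.β k) (sch.side k) (S := sch.side k) (G := G) :=
    diagCyclicTraceU_side_pos r.ρ (sch.β k) ⟨sch.L k, rfl⟩ r.continuous
  rw [gramPairing_eq_integral_layers_div, div_mul_cancel₀ _ hpos.ne']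

end Insertion

end Summit.QuantumFields.YangMills.Cruxes.DiagonalMirrorRPR.SignTwistedDiagonalTrace.WilsonDiagonal

end
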